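import Summits.AtomisticToContinuum.HydrodynamicLimit.Theorems.InformationPercolationEnginePercolationClosesChaosForecastTransferArch
import Summits.AtomisticToContinuum.HydrodynamicLimit.Theorems.InformationPercolationEnginePercolationClosesChaosForecastRetyped
import Summits.AtomisticToContinuum.HydrodynamicLimit.Theorems.InformationPercolationEnginePercolationClosesChaosCesaroStaticAssembly
import HarnessLib

/-!
# Forecast transfer S6 of the line `equilibrium-forecast-chain-rule` (crux `InformationPercolationEngine.PercolationClosesChaos`,
stmt-AtomisticToContinuum-15178) — piece H3: `CoarseLocalMaxwellianity → LocalCountUI → NoKineticIrregularity → NonGoodRare`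

Support file (`--supports stmt-AtomisticToContinuum-15178`) of the registered stub `stub_forecastTransfer` of skeleton v5
(`MesoForecastChaos → LocalCountUI → NoKineticIrregularity → CoarseLocalMaxwellianity → RevealedDefectStability →
KineticCellChaosLG`, worker S6 / W1 of lead c3): the third hypothesis `NonGoodRare` of the architecture `kineticCellChaosLG_of`
(piece A, `…ForecastTransferArch`) — OCCUPIED NON-GOOD units are rare in `LG`-mean — is DISCHARGED from the three LG-side
regularity inputs. The proof is fixed-`N` bookkeeping in the style of `lintegral_nonMaxwellian_le` (`…CesaroStaticAssembly`):

* `nonGoodIndicator_le` — the pointwise split per unit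
  `𝟙{occupied ∧ ¬ Good} ≤ 𝟙{occupied ∧ ϑ < relEnt} + 𝟙{occupied ∧ Dense} + 𝟙{actual cell ∧ nbhd populated ∧ (ϑ < inhom ∨ …)}`
  (`¬ GoodUnit = Dense ∨ ϑ < inhom ∨ ϑ < relEnt`; an occupied cell is an actual kinetic cell with a populated neighbourhood,
  `actual_and_nbhd_of_pop_nonempty`, so the guard of `NoKineticIrregularity` holds and its first disjunct fires);
* `measurableSet_occupied_nonGood` — the target unit event is Borel (pieces M of S5: `measurableSet_pop_nonempty`,
  `measurableSet_goodUnit`, flow measurability);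
* `nonGoodRare_of` (the headline) — `σ₀ := min`, `c₀ := max`, `N₀ := max` of the thresholds of `CoarseLocalMaxwellianity`
  `(ϑs, ϑ, δ₃/3)`, `LocalCountUI` (ii) `(φs; δ₃/3)` and `NoKineticIrregularity (ϑs, ϑ, δ₃/3, m₀ := 0)`; the four indicator
  families are box-supported (`indicator_pop_eq_zero_of_not_mem`, `cellOf_mem_cellBox`), so `unitAvg_add'` / `unitAvg_mono`
  turn the pointwise split into `V ≤ V_C + V_D + V_I` for the unit averages; `∫⁻ ofReal V ≤ Σ ∫⁻ ofReal Vᵢ ≤ 3 · ofReal (δ₃/3)`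
  (`lintegral_add_left` with the measurable `V_C`, `V_D`), and the Bochner mean `unitMean = ∫ V dLG = (∫⁻ ofReal V).toReal ≤ δ₃`
  (`integral_eq_lintegral_of_nonneg_ae`, `V ≥ 0` measurable).
-/

noncomputable section

open MeasureTheory Set Filter Topology
open scoped ENNReal BigOperators Classical
open Literature.Analysis.FluidPDE Literature.MathematicalPhysics.KineticTheory
open Literature.MathematicalPhysics.KineticTheory.VelocityBlindPlacement

namespace Summit.AtomisticToContinuum.HydrodynamicLimit.Theorems.EquilibriumForecastLine

variable {σ : ℝ} {N : ℕ}

/-! ## The pointwise split of the non-good indicator -/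

/-- **The pointwise split of the `NonGoodRare` indicator**: occupied ∧ non-good ≤ (occupied ∧ non-Maxwellian) +
(occupied ∧ packed) + (actual cell with populated neighbourhood ∧ (inhomogeneous ∨ occupied by fewer than `m₀` spheres)) — for
every floor `m₀` (only the first disjunct is used: an occupied, not packed, `ϑ`-Maxwellian, `ϑ`-homogeneous cell is good).
[folklore] -/
theorem nonGoodIndicator_le {c : ℝ} (hh : 0 ≤ c * meanFreePath σ N) (ϑs ϑ φs : ℝ) (m₀ : ℕ) (w : Phase N) (q : Cell) :
    (if (pop c σ N w q).Nonempty ∧ ¬ GoodUnit ϑs ϑ φs c σ N w q then (1 : ℝ) else 0) ≤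
      (if (pop c σ N w q).Nonempty ∧ ϑ < relEnt ϑs w (pop c σ N w q) then (1 : ℝ) else 0) +
        (if (pop c σ N w q).Nonempty ∧ Dense φs c σ N w q then (1 : ℝ) else 0) +
        (if (∃ x : T3, cellOf c σ N x = q) ∧ (nbhd c σ N w q).Nonempty ∧
            (ϑ < inhom ϑs w (pop c σ N w q) (nbhd c σ N w q) ∨
              ((pop c σ N w q).Nonempty ∧ (pop c σ N w q).card < m₀)) then (1 : ℝ) else 0) := by
  have h1 : (0 : ℝ) ≤ (if (pop c σ N w q).Nonempty ∧ ϑ < relEnt ϑs w (pop c σ N w q) then (1 : ℝ) else 0) := by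
    positivity
  have h2 : (0 : ℝ) ≤ (if (pop c σ N w q).Nonempty ∧ Dense φs c σ N w q then (1 : ℝ) else 0) := by positivity
  have h3 : (0 : ℝ) ≤ (if (∃ x : T3, cellOf c σ N x = q) ∧ (nbhd c σ N w q).Nonempty ∧
      (ϑ < inhom ϑs w (pop c σ N w q) (nbhd c σ N w q) ∨
        ((pop c σ N w q).Nonempty ∧ (pop c σ N w q).card < m₀)) then (1 : ℝ) else 0) := by
    positivity
  by_cases h : (pop c σ N w q).Nonempty ∧ ¬ GoodUnit ϑs ϑ φs c σ N w q
  · rw [if_pos h]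
    obtain ⟨hne, hng⟩ := h
    by_cases hD : Dense φs c σ N w q
    · have e2 : (if (pop c σ N w q).Nonempty ∧ Dense φs c σ N w q then (1 : ℝ) else 0) = 1 := if_pos ⟨hne, hD⟩
      linarith
    · by_cases hI : ϑ < inhom ϑs w (pop c σ N w q) (nbhd c σ N w q)
      · have hg := actual_and_nbhd_of_pop_nonempty hh w q hne
        have e3 : (if (∃ x : T3, cellOf c σ N x = q) ∧ (nbhd c σ N w q).Nonempty ∧
            (ϑ < inhom ϑs w (pop c σ N w q) (nbhd c σ N w q) ∨
              ((pop c σ N w q).Nonempty ∧ (pop c σ N w q).card < m₀)) then (1 : ℝ) else 0) = 1 :=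
          if_pos ⟨hg.1, hg.2, Or.inl hI⟩
        linarith
      · have hR : Regular ϑs ϑ φs c σ N w q := ⟨hD, not_lt.1 hI⟩
        have hE : ϑ < relEnt ϑs w (pop c σ N w q) := by
          by_contra hle
          exact hng ⟨hR, not_lt.1 hle⟩
        have e1 : (if (pop c σ N w q).Nonempty ∧ ϑ < relEnt ϑs w (pop c σ N w q) then (1 : ℝ) else 0) = 1 :=
          if_pos ⟨hne, hE⟩
        linarith
  · rw [if_neg h]
    linarith

/-- The occupied-and-non-good event of `NonGoodRare` at time `t` is measurable. [folklore] -/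
theorem measurableSet_occupied_nonGood (Φ : Flow σ N) (ϑs ϑ φs c t : ℝ) (q : Cell) :
    MeasurableSet {z : Phase N | (pop c σ N (Φ.flow t z) q).Nonempty ∧ ¬ GoodUnit ϑs ϑ φs c σ N (Φ.flow t z) q} :=
  ((measurableSet_pop_nonempty c σ q).preimage (Φ.measurable_flow t)).inter
    ((measurableSet_goodUnit ϑs ϑ φs c σ q).preimage (Φ.measurable_flow t)).compl

/-! ## H3 from the three LG-side regularity inputs -/

/-- **`CoarseLocalMaxwellianity → LocalCountUI → NoKineticIrregularity → NonGoodRare`** (H3 of the architecture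
`kineticCellChaosLG_of`, discharged): `σ₀ := min (σ_CLM, σ_UI(φs), σ_NKI)`; given `(σ, Φ, τ, ϑs, ϑ, δ₃)` the three inputs at
tolerance `δ₃/3` (`NoKineticIrregularity` with floor `m₀ := 0`), `c₀ := max`, `N₀ := max`; then the pointwise split
`nonGoodIndicator_le` of the unit averages, `∫⁻ ofReal V dLG ≤ 3 · ofReal (δ₃/3)`, and `unitMean = (∫⁻ ofReal V dLG).toReal`.
[folklore] -/
theorem nonGoodRare_of : CoarseLocalMaxwellianity → LocalCountUI → NoKineticIrregularity → NonGoodRare := by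
  intro hclm hui hnki φs hφs a₀ θ₀ u₀ ha hθ hu ha0 hθ0
  obtain ⟨σ₁, hσ₁, H1⟩ := hclm a₀ θ₀ u₀ ha hθ hu ha0 hθ0
  obtain ⟨σ₂, hσ₂, H2⟩ := hui φs hφs a₀ θ₀ u₀ ha hθ hu ha0 hθ0
  obtain ⟨σ₃, hσ₃, H3⟩ := hnki a₀ θ₀ u₀ ha hθ hu ha0 hθ0
  refine ⟨min σ₁ (min σ₂ σ₃), by positivity, ?_⟩
  intro σ hσ hσlt Φ τ hτ ϑs ϑ δ₃ hϑs hϑ hδ₃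
  have hσ₁' : σ < σ₁ := hσlt.trans_le (min_le_left _ _)
  have hσ₂' : σ < σ₂ := hσlt.trans_le ((min_le_right _ _).trans (min_le_left _ _))
  have hσ₃' : σ < σ₃ := hσlt.trans_le ((min_le_right _ _).trans (min_le_right _ _))
  have hδ' : 0 < δ₃ / 3 := by positivity
  -- the thresholds of the three inputs at tolerance `δ₃ / 3`
  obtain ⟨c₁, hc₁, H1c⟩ := H1 σ hσ hσ₁' Φ τ hτ ϑs ϑ (δ₃ / 3) hϑs hϑ hδ'
  obtain ⟨c₂, hc₂, H2c⟩ := (H2 σ hσ hσ₂' Φ τ hτ (δ₃ / 3) hδ').2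
  obtain ⟨c₃, hc₃, H3c⟩ := H3 σ hσ hσ₃' Φ τ hτ ϑs ϑ (δ₃ / 3) 0 hϑs hϑ hδ'
  refine ⟨max c₁ (max c₂ c₃), lt_max_of_lt_left hc₁, fun c hc => ?_⟩
  have hc₁' : c₁ ≤ c := (le_max_left _ _).trans hc
  have hc₂' : c₂ ≤ c := ((le_max_left _ _).trans (le_max_right _ _)).trans hc
  have hc₃' : c₃ ≤ c := ((le_max_right _ _).trans (le_max_right _ _)).trans hc
  have hc0 : 0 < c := hc₁.trans_le hc₁'
  obtain ⟨N₁, H1N⟩ := H1c c hc₁'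
  obtain ⟨N₂, H2N⟩ := H2c c hc₂'
  obtain ⟨N₃, H3N⟩ := H3c c hc₃'
  refine ⟨max N₁ (max N₂ N₃), fun N hN => ?_⟩
  have hN₁ : N₁ ≤ N := (le_max_left _ _).trans hN
  have hN₂ : N₂ ≤ N := ((le_max_left _ _).trans (le_max_right _ _)).trans hN
  have hN₃ : N₃ ≤ N := ((le_max_right _ _).trans (le_max_right _ _)).trans hN
  have hh : 0 < c * meanFreePath σ N := mul_pos hc0 (meanFreePath_pos hσ N)
  -- the law and the four unit-average families, as functions of the datum
  set μ : Measure (Phase N) := localGibbsLaw σ a₀ u₀ θ₀ N (Φ N) with hμ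
  set V : Phase N → ℝ := fun z => unitAvg c σ N τ fun k q =>
    if (pop c σ N ((Φ N).flow ((k : ℝ) * stepLen c σ N) z) q).Nonempty ∧
      ¬ GoodUnit ϑs ϑ φs c σ N ((Φ N).flow ((k : ℝ) * stepLen c σ N) z) q then (1 : ℝ) else 0 with hV
  set FC : Phase N → ℝ := fun z => unitAvg c σ N τ fun k q =>
    if (pop c σ N ((Φ N).flow ((k : ℝ) * stepLen c σ N) z) q).Nonempty ∧
      ϑ < relEntAt ϑs c σ N (Φ N) ((k : ℝ) * stepLen c σ N) q z then (1 : ℝ) else 0 with hFC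
  set FD : Phase N → ℝ := fun z => unitAvg c σ N τ fun k q =>
    if (pop c σ N ((Φ N).flow ((k : ℝ) * stepLen c σ N) z) q).Nonempty ∧
      Dense φs c σ N ((Φ N).flow ((k : ℝ) * stepLen c σ N) z) q then (1 : ℝ) else 0 with hFD
  set FI : Phase N → ℝ := fun z => unitAvg c σ N τ fun k q =>
    if (∃ x : T3, cellOf c σ N x = q) ∧ (nbhd c σ N ((Φ N).flow ((k : ℝ) * stepLen c σ N) z) q).Nonempty ∧
        (ϑ < inhom ϑs ((Φ N).flow ((k : ℝ) * stepLen c σ N) z)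
            (pop c σ N ((Φ N).flow ((k : ℝ) * stepLen c σ N) z) q)
            (nbhd c σ N ((Φ N).flow ((k : ℝ) * stepLen c σ N) z) q) ∨
          ((pop c σ N ((Φ N).flow ((k : ℝ) * stepLen c σ N) z) q).Nonempty ∧
            (pop c σ N ((Φ N).flow ((k : ℝ) * stepLen c σ N) z) q).card < 0)) then (1 : ℝ) else 0 with hFI
  have eC : ∫⁻ z, ENNReal.ofReal (FC z) ∂μ ≤ ENNReal.ofReal (δ₃ / 3) := H1N N hN₁
  have eD : ∫⁻ z, ENNReal.ofReal (FD z) ∂μ ≤ ENNReal.ofReal (δ₃ / 3) := H2N N hN₂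
  have eI : ∫⁻ z, ENNReal.ofReal (FI z) ∂μ ≤ ENNReal.ofReal (δ₃ / 3) := H3N N hN₃
  -- box support of the four families
  have hboxV : ∀ (z : Phase N) (k : ℕ), ∀ q ∉ cellBox (c * meanFreePath σ N),
      (if (pop c σ N ((Φ N).flow ((k : ℝ) * stepLen c σ N) z) q).Nonempty ∧
        ¬ GoodUnit ϑs ϑ φs c σ N ((Φ N).flow ((k : ℝ) * stepLen c σ N) z) q then (1 : ℝ) else 0) = 0 :=
    fun z k q hq => indicator_pop_eq_zero_of_not_mem hh (Φ N)
      (fun k q z => ¬ GoodUnit ϑs ϑ φs c σ N ((Φ N).flow ((k : ℝ) * stepLen c σ N) z) q) z k hq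
  have hboxC : ∀ (z : Phase N) (k : ℕ), ∀ q ∉ cellBox (c * meanFreePath σ N),
      (if (pop c σ N ((Φ N).flow ((k : ℝ) * stepLen c σ N) z) q).Nonempty ∧
        ϑ < relEntAt ϑs c σ N (Φ N) ((k : ℝ) * stepLen c σ N) q z then (1 : ℝ) else 0) = 0 :=
    fun z k q hq => indicator_pop_eq_zero_of_not_mem hh (Φ N)
      (fun k q z => ϑ < relEntAt ϑs c σ N (Φ N) ((k : ℝ) * stepLen c σ N) q z) z k hq
  have hboxD : ∀ (z : Phase N) (k : ℕ), ∀ q ∉ cellBox (c * meanFreePath σ N),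
      (if (pop c σ N ((Φ N).flow ((k : ℝ) * stepLen c σ N) z) q).Nonempty ∧
        Dense φs c σ N ((Φ N).flow ((k : ℝ) * stepLen c σ N) z) q then (1 : ℝ) else 0) = 0 :=
    fun z k q hq => indicator_pop_eq_zero_of_not_mem hh (Φ N)
      (fun k q z => Dense φs c σ N ((Φ N).flow ((k : ℝ) * stepLen c σ N) z) q) z k hq
  have hboxI : ∀ (z : Phase N) (k : ℕ), ∀ q ∉ cellBox (c * meanFreePath σ N),
      (if (∃ x : T3, cellOf c σ N x = q) ∧ (nbhd c σ N ((Φ N).flow ((k : ℝ) * stepLen c σ N) z) q).Nonempty ∧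
          (ϑ < inhom ϑs ((Φ N).flow ((k : ℝ) * stepLen c σ N) z)
              (pop c σ N ((Φ N).flow ((k : ℝ) * stepLen c σ N) z) q)
              (nbhd c σ N ((Φ N).flow ((k : ℝ) * stepLen c σ N) z) q) ∨
            ((pop c σ N ((Φ N).flow ((k : ℝ) * stepLen c σ N) z) q).Nonempty ∧
              (pop c σ N ((Φ N).flow ((k : ℝ) * stepLen c σ N) z) q).card < 0)) then (1 : ℝ) else 0) = 0 := by
    intro z k q hq
    rw [if_neg]
    rintro ⟨⟨x, hx⟩, -⟩
    exact hq (hx ▸ cellOf_mem_cellBox hh x)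
  -- pointwise split of the unit averages
  have hsplit : ∀ z, V z ≤ FC z + FD z + FI z := by
    intro z
    rw [hV, hFC, hFD, hFI]
    simp only
    rw [← unitAvg_add' τ (hboxC z) (hboxD z), ← unitAvg_add' τ (fun k q hq => by
      rw [hboxC z k q hq, hboxD z k q hq, add_zero]) (hboxI z)]
    refine unitAvg_mono hh.le (hboxV z) (fun k q hq => by
      rw [hboxC z k q hq, hboxD z k q hq, hboxI z k q hq]; ring) ?_
    intro k q
    exact nonGoodIndicator_le hh.le ϑs ϑ φs 0 _ q
  have hV0 : ∀ z, 0 ≤ V z := fun z =>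
    unitAvg_nonneg hh.le (hboxV z) fun k q => by positivity
  have hC0 : ∀ z, 0 ≤ FC z := fun z =>
    unitAvg_nonneg hh.le (hboxC z) fun k q => by positivity
  have hD0 : ∀ z, 0 ≤ FD z := fun z =>
    unitAvg_nonneg hh.le (hboxD z) fun k q => by positivity
  have hI0 : ∀ z, 0 ≤ FI z := fun z =>
    unitAvg_nonneg hh.le (hboxI z) fun k q => by positivity
  -- measurability of the target, the non-Maxwellian and the packed families
  have hmV : Measurable V := by
    refine measurable_unitAvg_indicator τ (fun k q z =>
      (pop c σ N ((Φ N).flow ((k : ℝ) * stepLen c σ N) z) q).Nonempty ∧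
        ¬ GoodUnit ϑs ϑ φs c σ N ((Φ N).flow ((k : ℝ) * stepLen c σ N) z) q) (fun k q => ?_) hboxV
    exact measurableSet_occupied_nonGood (Φ N) ϑs ϑ φs c _ q
  have hmC : Measurable FC := by
    refine measurable_unitAvg_indicator τ (fun k q z =>
      (pop c σ N ((Φ N).flow ((k : ℝ) * stepLen c σ N) z) q).Nonempty ∧
        ϑ < relEntAt ϑs c σ N (Φ N) ((k : ℝ) * stepLen c σ N) q z) (fun k q => ?_) hboxC
    exact measurableSet_nonMaxwellian (Φ N) ϑs ϑ c _ q
  have hmD : Measurable FD := by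
    refine measurable_unitAvg_indicator τ (fun k q z =>
      (pop c σ N ((Φ N).flow ((k : ℝ) * stepLen c σ N) z) q).Nonempty ∧
        Dense φs c σ N ((Φ N).flow ((k : ℝ) * stepLen c σ N) z) q) (fun k q => ?_) hboxD
    exact ((measurableSet_pop_nonempty c σ q).preimage ((Φ N).measurable_flow _)).inter
      ((measurableSet_dense φs c σ q).preimage ((Φ N).measurable_flow _))
  -- integrate the split
  have hlin : ∫⁻ z, ENNReal.ofReal (V z) ∂μ ≤ ENNReal.ofReal δ₃ :=
    calc ∫⁻ z, ENNReal.ofReal (V z) ∂μ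
        ≤ ∫⁻ z, ENNReal.ofReal (FC z) + ENNReal.ofReal (FD z) + ENNReal.ofReal (FI z) ∂μ := by
          refine lintegral_mono fun z => ?_
          rw [← ENNReal.ofReal_add (hC0 z) (hD0 z), ← ENNReal.ofReal_add (add_nonneg (hC0 z) (hD0 z)) (hI0 z)]
          exact ENNReal.ofReal_le_ofReal (hsplit z)
      _ = (∫⁻ z, ENNReal.ofReal (FC z) ∂μ) + (∫⁻ z, ENNReal.ofReal (FD z) ∂μ) +
            ∫⁻ z, ENNReal.ofReal (FI z) ∂μ := by
          have hCD : Measurable fun z => ENNReal.ofReal (FC z) + ENNReal.ofReal (FD z) :=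
            hmC.ennreal_ofReal.add hmD.ennreal_ofReal
          rw [lintegral_add_left hCD, lintegral_add_left hmC.ennreal_ofReal]
      _ ≤ ENNReal.ofReal (δ₃ / 3) + ENNReal.ofReal (δ₃ / 3) + ENNReal.ofReal (δ₃ / 3) :=
          add_le_add (add_le_add eC eD) eI
      _ = ENNReal.ofReal δ₃ := by
          rw [← ENNReal.ofReal_add hδ'.le hδ'.le, ← ENNReal.ofReal_add (add_nonneg hδ'.le hδ'.le) hδ'.le]
          congr 1
          ring
  -- from the lintegral to the Bochner mean
  have hint : ∫ z, V z ∂μ = (∫⁻ z, ENNReal.ofReal (V z) ∂μ).toReal :=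
    integral_eq_lintegral_of_nonneg_ae (ae_of_all μ hV0) hmV.aestronglyMeasurable
  show ∫ z, V z ∂μ ≤ δ₃
  rw [hint]
  exact ENNReal.toReal_le_of_le_ofReal hδ₃.le hlin

end Summit.AtomisticToContinuum.HydrodynamicLimit.Theorems.EquilibriumForecastLine

end
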